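import Literature.MathematicalPhysics.QuantumFieldTheory.Balaban1983to89.B8CubeMemberTorusChart
import Literature.MathematicalPhysics.QuantumFieldTheory.Balaban1983to89.B9Eq316TowerFlatIsOneStep

/-!
# `Balaban1983to89.B8CubeMemberTorusAverages` — TRANSPLANT STEP T3a of the N05 flat road: THE AVERAGING DICTIONARY
# `Q_j` (torus, [Balaban1984PropagatorsI] (1.18)) ↔ `L^jη·Q_j` (the flat composite `linCovIter L 1` of [Balaban1985Averaging] (127)) UNDER THE CHART

statement-level skeleton of published theorems with citation tags; proofs where landed; nothing here is a claim about the
Yang–Mills mass gap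

`[Balaban1984PropagatorsI]` (1.18) p. 20 («(Q_kA)_b = Σ_{x∈B^k(b₋)} η^{d+1} A([x, x(b)])»); `[Balaban1985Averaging]` (127) p. 37 (the composite of the linear parts),
(122) p. 36; `[Balaban1985RegularSpaces]` (1.56) p. 86 («L^jηQ_jA = B₁ … on Λ_j»), (1.31) p. 82.  PDF held: `paper:balaban1985-cmp99-regular-spaces-gauge-fixing`.

CITATION HEADER (lean-in-tree rule).  Cell `pub-ymgap` (YM Track A, HUMAN RULING D-0062), DAG node N05 = [B8], seat `pub-ymgap-dag-n05-c` (g12), the seat's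
`TRANSPLANT-DESIGN.md` step T3a.  WHY THIS FILE.  The torus reading of (1.59) (lit-balaban sub-row G-F3′-L0∕B8) takes the averaging datum as `QE (domT hN D hk) A = B` with
`(QE A)(j, b) = bondAvgIter j A b` (p21's NORMALISED iterated straight-segment average of [B5] (1.18)) and the size line `|B(j, b)| ≤ n_B·(Lʲη)⁻¹`; the cube member's target
`B8Ineq159FlatCubeMemberPrinted.Ineq159FlatCubeMemberPrinted` carries the datum as `‖linCovIter L 1 (iEta η φ) j c‖ ≤ N` (the UN-normalised flat composite of [3] (127) at
`U₀ = 1`, = `iLʲη·(Q_jφ)(c)`).  THIS FILE identifies the two under the chart of `B8CubeMemberTorusChart`: §1 coarse labels and the block of order `j` of a coarse torus site as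
the image of an integer box (`B5Eq118OneStroke.mem_iterBlock_iff`), §2 ★ `bondAvgIter_liftB`: `Lʲ · bondAvgIter j (liftB g ψ) b = g(linQ (Lʲ) ψ (Lʲ•labels b₋) (dir b))` for
`ψ` supported `Lʲ`-deep, §3 the currency lemma ★ `norm_bondAvgIter_liftB_le`: `(Lʲη)·|bondAvgIter j (liftB g ψ) b| ≤ ‖linCovIter L 1 (iEta η ψ) j (labels b₋, dir b)‖` for
`‖g‖ ≤ 1` (`g = re, im`).

HONEST SCOPE ∕ NOT CLAIMED.  Bookkeeping (two normalisations of the same block-and-segment sum); no estimate.  Count-neutral; N05 NOT discharged; one finite `T⁴` programme at fixed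
`ε`, Bałaban as printed; nothing continuum ∕ ℝ⁴ ∕ OS ∕ mass-gap ∕ Clay.  No `sorry`, no `instance`, no `notation`; one plumbing `def` (`labelsJ`).  Unit `pub-ymgap-dag-n05-c` (g12),
2026-08-27.

RELATED IN THE TREE, NOT DUPLICATED: `B5Eq118OneStroke.bondAvgIter_eq_blockSum`∕`mem_iterBlock_iff`∕`val_iterBlockOf` (p21∕r03 lineage; USED), `B7Prop4Flat.linQ_eq_sum`∕
`linQIter_eq_linQ_pow` and `B9Eq316TowerFlatIsOneStep.linCovIter_one_left` (b2b∕n06 lineage; USED), `B6GlobalChartV1.blk_toBox` (the same block dictionary for p21's `blk`).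
-/
noncomputable section

namespace Literature.MathematicalPhysics.QuantumFieldTheory.Balaban1983to89.B8CubeMemberTorusAverages

open B6GlobalChartV1 (PV)
open B7Prop1Explicit (e e_apply boxVec)
open B8CubeMemberTorusChart (toTorus labels toTorus_labels labels_toTorus labels_toTorus_apply labels_nonneg labels_lt toTorus_add_e DeepSupp
  apply_labels_toTorus_add liftB liftB_apply)
open B5Eq118OneStroke (iterBlock iterBlockOf mem_iterBlock mem_iterBlock_iff val_iterBlockOf bondAvgIter_eq_blockSum)
open LatticeFieldCalculus (bondAvgIter segSum runSite runBond)
open B7Prop3Flat (linQ)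
open B7Prop4Flat (linQ_eq_sum linQIter linQIter_eq_linQ_pow)
open B7Prop4GeneralLevels (linCovIter)
open B9Eq316TowerFlatIsOneStep (linCovIter_one_left)
open B8Eq146AExpansion (iEta)

variable {d ℓ mV KV : ℕ} {hd : 1 ≤ d + 1} {hL : Odd (ℓ + 1) ∧ 1 < ℓ + 1}

/-! ## §1 Coarse labels; the block of order `j` of a coarse site is the image of an integer box -/

/-- The label vector of a site of the coarse torus `T^{(j)}` (labels in `[0, N∕Lʲ)`). [cite: Balaban1984PropagatorsI, (1.6) p.18, dictionary] -/
def labelsJ {j : ℕ} (y : Site (PV d ℓ mV KV hd hL) j) : Fin (d + 1) → ℤ := fun μ => ((y μ).val : ℤ)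

/-- at order `0` the coarse labels are the labels. [folklore] [cite: Balaban1984PropagatorsI, (1.6) p.18, dictionary] -/
theorem labelsJ_zero (y : Site (PV d ℓ mV KV hd hL) 0) : labelsJ y = labels y := rfl

/-- `t` steps along `e_μ` on the torus = translating the labels by `t·e_μ` and reducing. [cite: Balaban1984PropagatorsI, (1.7) p.18, dictionary] -/
theorem runSite_eq_toTorus (x : Site (PV d ℓ mV KV hd hL) 0) (μ : Fin (d + 1)) (t : ℕ) :
    runSite x μ t = toTorus (labels x + (t : ℤ) • e μ) := by
  funext ν
  simp only [runSite, Function.update_apply, toTorus, labels, Pi.add_apply, Pi.smul_apply, e_apply, smul_eq_mul]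
  split_ifs with h
  · subst h; push_cast; simp
  · simp

/-- **THE BLOCK OF ORDER `j` IS AN INTEGER BOX OF LABELS**: `x ∈ B^j(y)` iff `labels x = Lʲ·labelsJ y + r` with `r ∈ [0, Lʲ)^{d+1}` (standing range `j ≤ m + K`).
[cite: Balaban1984PropagatorsI, (1.6) p.18, (1.18) p.20] -/
theorem mem_iterBlock_iff_labels {j : ℕ} (hj : j ≤ mV + KV) (y : Site (PV d ℓ mV KV hd hL) j) (x : Site (PV d ℓ mV KV hd hL) 0) :
    x ∈ iterBlock j y ↔ ∀ μ, (((ℓ + 1) ^ j : ℕ) : ℤ) * labelsJ y μ ≤ labels x μ ∧ labels x μ < (((ℓ + 1) ^ j : ℕ) : ℤ) * (labelsJ y μ + 1) := by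
  rw [mem_iterBlock_iff hj]
  refine forall_congr' fun μ => ?_
  simp only [labels, labelsJ]
  have hLj : 0 < (ℓ + 1) ^ j := pow_pos (Nat.succ_pos ℓ) j
  constructor
  · intro h
    have h1 := Nat.div_mul_le_self (x μ).val ((ℓ + 1) ^ j)
    have h2 := Nat.lt_div_mul_add hLj (a := (x μ).val)
    rw [h] at h1 h2
    constructor
    · have : (ℓ + 1) ^ j * (y μ).val ≤ (x μ).val := by rw [mul_comm]; exact h1
      exact_mod_cast this
    · have : (x μ).val < (ℓ + 1) ^ j * ((y μ).val + 1) := by rw [mul_add, mul_one, mul_comm]; exact h2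
      exact_mod_cast this
  · rintro ⟨h1, h2⟩
    have h1' : (ℓ + 1) ^ j * (y μ).val ≤ (x μ).val := by exact_mod_cast h1
    have h2' : (x μ).val < (ℓ + 1) ^ j * ((y μ).val + 1) := by exact_mod_cast h2
    exact Nat.div_eq_of_lt_le (by rw [mul_comm]; exact h1') (by rw [mul_comm]; exact h2')

/-- the labels of a coarse site are below `N ∕ Lʲ`: `Lʲ·(labelsJ y μ + 1) ≤ N`. [folklore] [cite: Balaban1984PropagatorsI, (1.6) p.18, dictionary] -/
theorem pow_mul_labelsJ_succ_le {j : ℕ} (hj : j ≤ mV + KV) (y : Site (PV d ℓ mV KV hd hL) j) (μ : Fin (d + 1)) :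
    (((ℓ + 1) ^ j : ℕ) : ℤ) * (labelsJ y μ + 1) ≤ ((PV d ℓ mV KV hd hL).sitesPerDir 0 : ℕ) := by
  have hlt : (y μ).val < (PV d ℓ mV KV hd hL).sitesPerDir j := ZMod.val_lt (y μ)
  have hN : (PV d ℓ mV KV hd hL).sitesPerDir 0 = (ℓ + 1) ^ j * (PV d ℓ mV KV hd hL).sitesPerDir j := by
    simp only [Params.sitesPerDir, Nat.sub_zero]
    show 2 * (ℓ + 1) ^ (mV + KV) = (ℓ + 1) ^ j * (2 * (ℓ + 1) ^ (mV + KV - j))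
    rw [mul_left_comm, ← pow_add, Nat.add_sub_cancel' hj]
  have h : (ℓ + 1) ^ j * ((y μ).val + 1) ≤ (PV d ℓ mV KV hd hL).sitesPerDir 0 := by
    rw [hN]; exact Nat.mul_le_mul_left _ hlt
  simp only [labelsJ]
  exact_mod_cast h

/-- labels of the parametrised points of a block: `labels (toTorus (Lʲ·labelsJ y + r)) = Lʲ·labelsJ y + r` for `r ∈ [0, Lʲ)^{d+1}`.
[cite: Balaban1984PropagatorsI, (1.6) p.18, dictionary] -/
theorem labels_toTorus_corner {j : ℕ} (hj : j ≤ mV + KV) (y : Site (PV d ℓ mV KV hd hL) j) (r : Fin (d + 1) → Fin ((ℓ + 1) ^ j)) :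
    labels (toTorus (hd := hd) (hL := hL) (mV := mV) (KV := KV) (ℓ := ℓ) ((((ℓ + 1) ^ j : ℕ) : ℤ) • labelsJ y + boxVec ((ℓ + 1) ^ j) r)) =
      (((ℓ + 1) ^ j : ℕ) : ℤ) • labelsJ y + boxVec ((ℓ + 1) ^ j) r := by
  refine labels_toTorus fun μ => ⟨?_, ?_⟩
  · simp only [Pi.add_apply, Pi.smul_apply, smul_eq_mul, boxVec, labelsJ]; positivity
  · have h1 := pow_mul_labelsJ_succ_le hj y μ
    have h2 : ((r μ : ℕ) : ℤ) < (((ℓ + 1) ^ j : ℕ) : ℤ) := by exact_mod_cast (r μ).isLt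
    simp only [Pi.add_apply, Pi.smul_apply, smul_eq_mul, boxVec]
    linarith

/-- the parametrised points lie in the block. [cite: Balaban1984PropagatorsI, (1.6) p.18, dictionary] -/
theorem toTorus_corner_mem_iterBlock {j : ℕ} (hj : j ≤ mV + KV) (y : Site (PV d ℓ mV KV hd hL) j) (r : Fin (d + 1) → Fin ((ℓ + 1) ^ j)) :
    toTorus (hd := hd) (hL := hL) (mV := mV) (KV := KV) (ℓ := ℓ) ((((ℓ + 1) ^ j : ℕ) : ℤ) • labelsJ y + boxVec ((ℓ + 1) ^ j) r) ∈ iterBlock j y := by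
  rw [mem_iterBlock_iff_labels hj, labels_toTorus_corner hj]
  intro μ
  have h2 : ((r μ : ℕ) : ℤ) < (((ℓ + 1) ^ j : ℕ) : ℤ) := by exact_mod_cast (r μ).isLt
  simp only [Pi.add_apply, Pi.smul_apply, smul_eq_mul, boxVec]
  constructor
  · have : (0 : ℤ) ≤ ((r μ : ℕ) : ℤ) := by positivity
    linarith
  · linarith

/-- **every coarse site has a fine site over it** (its block corner). [cite: Balaban1984PropagatorsI, (1.6) p.18, dictionary] -/
theorem exists_iterBlockOf_eq {j : ℕ} (hj : j ≤ mV + KV) (y : Site (PV d ℓ mV KV hd hL) j) : ∃ x : Site (PV d ℓ mV KV hd hL) 0, iterBlockOf j x = y := by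
  have hLj : 0 < (ℓ + 1) ^ j := pow_pos (Nat.succ_pos ℓ) j
  exact ⟨_, (mem_iterBlock j y _).1 (toTorus_corner_mem_iterBlock hj y fun _ => ⟨0, hLj⟩)⟩

/-- **THE INTEGER BOX PARAMETRISES THE BLOCK**: `r ↦ toTorus (Lʲ·labelsJ y + r)` is a bijection from `[0, Lʲ)^{d+1}` onto `B^j(y)`, with labels `Lʲ·labelsJ y + r`.
[cite: Balaban1984PropagatorsI, (1.6) p.18, (1.18) p.20, dictionary] -/
theorem sum_iterBlock_eq_sum_boxVec {M : Type*} [AddCommMonoid M] {j : ℕ} (hj : j ≤ mV + KV) (y : Site (PV d ℓ mV KV hd hL) j)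
    (F : (Fin (d + 1) → ℤ) → M) :
    ∑ x ∈ iterBlock j y, F (labels x) = ∑ r : Fin (d + 1) → Fin ((ℓ + 1) ^ j), F ((((ℓ + 1) ^ j : ℕ) : ℤ) • labelsJ y + boxVec ((ℓ + 1) ^ j) r) := by
  classical
  have hlab := labels_toTorus_corner (hd := hd) (hL := hL) (mV := mV) (KV := KV) (ℓ := ℓ) hj y
  have hmem := toTorus_corner_mem_iterBlock (hd := hd) (hL := hL) (mV := mV) (KV := KV) (ℓ := ℓ) hj y
  symm
  refine Finset.sum_nbij (fun r => toTorus ((((ℓ + 1) ^ j : ℕ) : ℤ) • labelsJ y + boxVec ((ℓ + 1) ^ j) r)) (fun r _ => hmem r) ?_ ?_ (fun r _ => by rw [hlab])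
  · -- injective
    intro r _ r' _ h
    have h' := congrArg labels h
    rw [hlab, hlab] at h'
    funext μ
    have hμ := congrFun h' μ
    simp only [Pi.add_apply, boxVec, add_right_inj, Nat.cast_inj] at hμ
    exact Fin.ext hμ
  · -- surjective
    intro x hx
    rw [Finset.mem_coe, mem_iterBlock_iff_labels hj] at hx
    refine ⟨fun μ => ⟨(labels x μ - (((ℓ + 1) ^ j : ℕ) : ℤ) * labelsJ y μ).toNat, ?_⟩, Finset.mem_coe.2 (Finset.mem_univ _), ?_⟩
    · have h1 := (hx μ).1
      have h2 := (hx μ).2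
      have h3 : labels x μ - (((ℓ + 1) ^ j : ℕ) : ℤ) * labelsJ y μ < (((ℓ + 1) ^ j : ℕ) : ℤ) := by linarith
      omega
    · have hv : ((((ℓ + 1) ^ j : ℕ) : ℤ) • labelsJ y +
          boxVec ((ℓ + 1) ^ j) fun μ => ⟨(labels x μ - (((ℓ + 1) ^ j : ℕ) : ℤ) * labelsJ y μ).toNat, by
            have h1 := (hx μ).1
            have h2 := (hx μ).2
            have h3 : labels x μ - (((ℓ + 1) ^ j : ℕ) : ℤ) * labelsJ y μ < (((ℓ + 1) ^ j : ℕ) : ℤ) := by linarith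
            omega⟩) = labels x := by
        funext μ
        have h1 := (hx μ).1
        simp only [Pi.add_apply, Pi.smul_apply, smul_eq_mul, boxVec]
        rw [Int.toNat_of_nonneg (by linarith)]
        ring
      show toTorus _ = x
      rw [hv, toTorus_labels]

/-! ## §2 The iterated bond average of a lifted field is the flat composite average -/

/-- **THE STRAIGHT-SEGMENT SUM OF A LIFTED FIELD**: for `ψ` supported `r`-deep with `n ≤ r`, `Σ_{t<n} liftB g ψ ⟨x + t e_μ, μ⟩ = Σ_{t<n} g(ψ(labels x + t e_μ, μ))`.
[cite: Balaban1984PropagatorsI, (1.8) p.19 («A(Γ) = Σ_{b ⊂ Γ} A_b»), dictionary] -/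
theorem segSum_liftB {r : ℤ} (hr0 : 0 ≤ r) (hrN : r ≤ ((PV d ℓ mV KV hd hL).sitesPerDir 0 : ℕ)) (g : ℂ →ₗ[ℝ] ℝ)
    {ψ : (Fin (d + 1) → ℤ) → Fin (d + 1) → ℂ} (hψ : DeepSupp ((PV d ℓ mV KV hd hL).sitesPerDir 0) r ψ) (x : Site (PV d ℓ mV KV hd hL) 0)
    (μ : Fin (d + 1)) {n : ℕ} (hn : (n : ℤ) ≤ r + 1) :
    segSum (liftB g ψ) x μ n = ∑ t ∈ Finset.range n, g (ψ (labels x + (t : ℤ) • e μ) μ) := by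
  unfold segSum
  refine Finset.sum_congr rfl fun t ht => ?_
  have htn : t < n := Finset.mem_range.mp ht
  simp only [runBond, liftB_apply, runSite_eq_toTorus]
  have key := apply_labels_toTorus_add (f := ψ) hr0 hrN hψ x (v := (t : ℤ) • e μ) (fun κ => by
    rw [Pi.smul_apply, e_apply, smul_eq_mul]
    split_ifs
    · rw [mul_one, abs_of_nonneg (by positivity)]; omega
    · simp [hr0])
  rw [key]

/-- ★ **`Lʲ·Q_j = L(Q)ʲ` UNDER THE CHART**: for a bond field `ψ` of `ℤ^{d+1}` supported `Lʲ`-deep in the fundamental box and a coarse bond `b` of `T^{(j)}` (`j ≤ m + K`),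
`Lʲ · (Q_j liftB g ψ)(b) = g((linQ (Lʲ) ψ)(Lʲ·labelsJ b₋, dir b))` — the torus average (1.18) is normalised by `L^{−j(d+2)}` over block AND segment, the flat composite (127)
by `L^{−j(d+1)}` over the block only. [cite: Balaban1984PropagatorsI, (1.18) p.20; Balaban1985Averaging, (127) p.37, (122) p.36; Balaban1985RegularSpaces, (1.56) p.86] -/
theorem bondAvgIter_liftB {j : ℕ} (hj : j ≤ mV + KV) {r : ℤ} (hr : (((ℓ + 1) ^ j : ℕ) : ℤ) ≤ r) (hrN : r ≤ ((PV d ℓ mV KV hd hL).sitesPerDir 0 : ℕ))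
    (g : ℂ →ₗ[ℝ] ℝ) {ψ : (Fin (d + 1) → ℤ) → Fin (d + 1) → ℂ} (hψ : DeepSupp ((PV d ℓ mV KV hd hL).sitesPerDir 0) r ψ)
    (b : PBond (PV d ℓ mV KV hd hL) j) :
    (((ℓ + 1 : ℕ) : ℝ) ^ j) * bondAvgIter j (liftB g ψ) b =
      g (linQ ((ℓ + 1) ^ j) ψ ((((ℓ + 1) ^ j : ℕ) : ℤ) • labelsJ b.src) b.dir) := by
  have hLj : 0 < (ℓ + 1) ^ j := pow_pos (Nat.succ_pos ℓ) j
  have hr0 : 0 ≤ r := le_trans (by positivity) hr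
  rw [bondAvgIter_eq_blockSum j hj, linQ_eq_sum, map_sum]
  -- the block sum of the segment sums, through the chart
  have hseg : ∀ x : Site (PV d ℓ mV KV hd hL) 0, segSum (liftB g ψ) x b.dir ((ℓ + 1) ^ j) =
      ∑ t ∈ Finset.range ((ℓ + 1) ^ j), g (ψ (labels x + (t : ℤ) • e b.dir) b.dir) := fun x =>
    segSum_liftB hr0 hrN g hψ x b.dir (by have h := hr; push_cast at h ⊢; linarith)
  simp only [hseg]
  rw [sum_iterBlock_eq_sum_boxVec hj b.src (fun w => ∑ t ∈ Finset.range ((ℓ + 1) ^ j), g (ψ (w + (t : ℤ) • e b.dir) b.dir))]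
  rw [smul_eq_mul, Finset.mul_sum, Finset.mul_sum]
  refine Finset.sum_congr rfl fun rr _ => ?_
  rw [LinearMap.map_smul_of_tower, smul_eq_mul, map_sum, ← Fin.sum_univ_eq_sum_range]
  -- normalisations: `Lʲ · ((L^{d+2})ʲ)⁻¹ = ((Lʲ)^{d+1})⁻¹`
  have hnorm : (((ℓ + 1 : ℕ) : ℝ) ^ j) * ((((ℓ + 1 : ℕ) : ℝ) ^ (d + 1 + 1)) ^ j)⁻¹ = (((((ℓ + 1) ^ j : ℕ) : ℝ)) ^ (d + 1))⁻¹ := by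
    have hne : (((ℓ + 1 : ℕ) : ℝ)) ≠ 0 := by positivity
    push_cast at hne ⊢
    rw [← pow_mul, ← pow_mul]
    field_simp
    ring
  rw [← mul_assoc, hnorm]

/-! ## §3 The currency lemma: `(Lʲη)|Q_j(liftB)| ≤ ‖linCovIter L 1 (iEta η ψ) j‖` -/

/-- **`linQ` commutes with scalar multiplication** (it is a finite sum). [folklore] [cite: Balaban1985Averaging, (122) p.36] -/
theorem linQ_smul (N : ℕ) (c : ℂ) (B : (Fin (d + 1) → ℤ) → Fin (d + 1) → ℂ) (p : Fin (d + 1) → ℤ) (κ : Fin (d + 1)) :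
    linQ N (fun w ν => c • B w ν) p κ = c • linQ N B p κ := by
  rw [linQ_eq_sum, linQ_eq_sum, Finset.smul_sum]
  refine Finset.sum_congr rfl fun r _ => ?_
  rw [Finset.smul_sum, Finset.smul_sum, Finset.smul_sum]
  refine Finset.sum_congr rfl fun i _ => ?_
  rw [smul_comm]

/-- ★ **THE CURRENCY LEMMA**: for `ψ` bounded and supported `Lʲ`-deep, a real functional `g` with `|g z| ≤ ‖z‖`, `η > 0` and a coarse bond `b` of `T^{(j)}`:
`(Lʲη)·|Q_j(liftB g ψ)(b)| ≤ ‖linCovIter L 1 (iEta η ψ) j (labelsJ b₋, dir b)‖` — the torus size line `|B(j,b)| ≤ n_B(Lʲη)⁻¹` of the (1.59) reading follows from the member's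
`‖Lʲη·Q_j(iηφ)(c)‖ ≤ N` on print's class. [cite: Balaban1985RegularSpaces, (1.56) p.86, (1.59) p.86; Balaban1984PropagatorsI, (1.18) p.20; Balaban1985Averaging, (127) p.37] -/
theorem norm_bondAvgIter_liftB_le {j : ℕ} (hj : j ≤ mV + KV) {r : ℤ} (hr : (((ℓ + 1) ^ j : ℕ) : ℤ) ≤ r)
    (hrN : r ≤ ((PV d ℓ mV KV hd hL).sitesPerDir 0 : ℕ)) (g : ℂ →ₗ[ℝ] ℝ) (hg : ∀ z, |g z| ≤ ‖z‖)
    {ψ : (Fin (d + 1) → ℤ) → Fin (d + 1) → ℂ} (hψ : DeepSupp ((PV d ℓ mV KV hd hL).sitesPerDir 0) r ψ) {M : ℝ} (hM0 : 0 ≤ M) (hM : ∀ w ν, ‖ψ w ν‖ ≤ M)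
    {η : ℝ} (hη : 0 < η) (b : PBond (PV d ℓ mV KV hd hL) j) :
    ((((ℓ + 1 : ℕ) : ℝ) ^ j) * η) * |bondAvgIter j (liftB g ψ) b| ≤
      ‖linCovIter (ℓ + 1) (1 : (Fin (d + 1) → ℤ) → Fin (d + 1) → ℂˣ) (iEta η ψ) j (labelsJ b.src) b.dir‖ := by
  have hL1 : 1 ≤ ℓ + 1 := Nat.succ_pos ℓ
  have hLj0 : 0 < (((ℓ + 1 : ℕ) : ℝ) ^ j) := by positivity
  -- the flat composite at `U₀ = 1` is `linQ (Lʲ)` at the scaled site, and `iEta` pulls out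
  have hb : ∀ w ν, ‖iEta η ψ w ν‖ ≤ η * M := fun w ν => B8Eq146AExpansion.norm_iEta_le hη.le hM w ν
  rw [linCovIter_one_left (ℓ + 1) hL1 _ (by positivity) hb j, linQIter_eq_linQ_pow]
  have hi : linQ ((ℓ + 1) ^ j) (iEta η ψ) ((((ℓ + 1) ^ j : ℕ) : ℤ) • labelsJ b.src) b.dir =
      ((Complex.I : ℂ) * η) • linQ ((ℓ + 1) ^ j) ψ ((((ℓ + 1) ^ j : ℕ) : ℤ) • labelsJ b.src) b.dir := by
    rw [← linQ_smul]; rfl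
  rw [hi, norm_smul, norm_mul, Complex.norm_I, one_mul, Complex.norm_real, Real.norm_of_nonneg hη.le]
  have key := bondAvgIter_liftB hj hr hrN g hψ b
  have h1 : (((ℓ + 1 : ℕ) : ℝ) ^ j) * |bondAvgIter j (liftB g ψ) b| ≤ ‖linQ ((ℓ + 1) ^ j) ψ ((((ℓ + 1) ^ j : ℕ) : ℤ) • labelsJ b.src) b.dir‖ := by
    rw [← abs_of_pos hLj0, ← abs_mul, key]
    exact hg _
  calc (((ℓ + 1 : ℕ) : ℝ) ^ j) * η * |bondAvgIter j (liftB g ψ) b| = η * ((((ℓ + 1 : ℕ) : ℝ) ^ j) * |bondAvgIter j (liftB g ψ) b|) := by ring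
    _ ≤ η * ‖linQ ((ℓ + 1) ^ j) ψ ((((ℓ + 1) ^ j : ℕ) : ℤ) • labelsJ b.src) b.dir‖ := mul_le_mul_of_nonneg_left h1 hη.le

/-- **`linQ` of a translate by a block vector**: `linQ N (ψ) (p) = linQ N φ (p − N·v)` for `ψ = φ(· − N·v)` (the composite average of the translated member field is the member's
average at the translated coarse bond). [cite: Balaban1985Averaging, (122) p.36; Balaban1985RegularSpaces, p.98 («□_j is a sum of the big blocks»), dictionary] -/
theorem linQ_translate (N : ℕ) (φ : (Fin (d + 1) → ℤ) → Fin (d + 1) → ℂ) (v p : Fin (d + 1) → ℤ) (κ : Fin (d + 1)) :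
    linQ N (fun w ν => φ (w - (N : ℤ) • v) ν) p κ = linQ N φ (p - (N : ℤ) • v) κ := by
  rw [linQ_eq_sum, linQ_eq_sum]
  refine Finset.sum_congr rfl fun r _ => ?_
  congr 1
  refine Finset.sum_congr rfl fun i _ => ?_
  congr 1
  abel

/-- ★ **THE FLAT COMPOSITE AVERAGE OF THE TRANSLATED FIELD**: for bounded `φ`, `ψ = φ(· − Lʲ·v)` and `U₀ = 1`,
`linCovIter L 1 (iEta η ψ) j z κ = linCovIter L 1 (iEta η φ) j (z − v) κ`. [cite: Balaban1985Averaging, (127) p.37; Balaban1985RegularSpaces, (1.56) p.86, p.98, dictionary] -/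
theorem linCovIter_one_translate {j : ℕ} (φ : (Fin (d + 1) → ℤ) → Fin (d + 1) → ℂ) {M : ℝ} (hM0 : 0 ≤ M) (hM : ∀ w ν, ‖φ w ν‖ ≤ M)
    {η : ℝ} (hη : 0 ≤ η) (v z : Fin (d + 1) → ℤ) (κ : Fin (d + 1)) :
    linCovIter (ℓ + 1) (1 : (Fin (d + 1) → ℤ) → Fin (d + 1) → ℂˣ) (iEta η fun w ν => φ (w - (((ℓ + 1) ^ j : ℕ) : ℤ) • v) ν) j z κ =
      linCovIter (ℓ + 1) (1 : (Fin (d + 1) → ℤ) → Fin (d + 1) → ℂˣ) (iEta η φ) j (z - v) κ := by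
  have hL1 : 1 ≤ ℓ + 1 := Nat.succ_pos ℓ
  have hb : ∀ w ν, ‖iEta η φ w ν‖ ≤ η * M := fun w ν => B8Eq146AExpansion.norm_iEta_le hη hM w ν
  have hb' : ∀ w ν, ‖iEta η (fun w ν => φ (w - (((ℓ + 1) ^ j : ℕ) : ℤ) • v) ν) w ν‖ ≤ η * M := fun w ν =>
    B8Eq146AExpansion.norm_iEta_le hη (fun w ν => hM _ ν) w ν
  rw [linCovIter_one_left (ℓ + 1) hL1 _ (by positivity) hb' j, linCovIter_one_left (ℓ + 1) hL1 _ (by positivity) hb j,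
    linQIter_eq_linQ_pow, linQIter_eq_linQ_pow]
  have h := linQ_translate ((ℓ + 1) ^ j) (iEta η φ) v ((((ℓ + 1) ^ j : ℕ) : ℤ) • z) κ
  have e : (fun w ν => iEta η φ (w - (((ℓ + 1) ^ j : ℕ) : ℤ) • v) ν) = iEta η (fun w ν => φ (w - (((ℓ + 1) ^ j : ℕ) : ℤ) • v) ν) := rfl
  rw [e] at h
  rw [h, smul_sub]

end Literature.MathematicalPhysics.QuantumFieldTheory.Balaban1983to89.B8CubeMemberTorusAverages
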